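import Summits.CriticalPhenomena.PercolationContinuityZ3.Theorems.PercNearOneGluingNoHeavyLowerTailAntitheticCycleTII
import HarnessLib

/-!
# `NoHeavyLowerTail` (stmt-CriticalPhenomena-4575) — antithetic cluster pairs: PR4 ON A CYCLE in EXTENSION FORM with FORCED-RED pairs
# (HOME/MEMO-gen62.md §2 (P1)/(P4), prim-hp-2 gen 62)

Support file (`--supports stmt-CriticalPhenomena-4575`, hull-port prover `prim-hp-2`, gen 62).  No definitions, no named facts, no sorries;
standard axioms.  Setting of …AntitheticCycleTII: cycle `v 0 = s, …, v (n-1)` (`n ≥ 3`), `P = v p`, `Q = v q` (`0 < p, q < n`).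

`Antithetic.Cyc.termTwo_cycle_ext` generalises `Cyc.termTwo_cycle_nonneg` to an arbitrary EXTENSION `E'` of the cycle on which the events
`{P ∈ X}`, `{Q ∉ Y}` and red domination agree with those of the cycle (hev, hevY, hdomx — e.g. pendant trees hanging anywhere, by
`Antithetic.Box.mem_path_iff` / `dom_path`), and to a set `frc` of FORCED-RED cycle pairs (the sum runs over colourings in which they are
red): for all super-odd twisted-monotone `K₁, K₂`, `0 ≤ Σ_{T : forced red, P ∈ X_{E'} T, Q ∉ Y_{E'} T} K₁K₂(X_{E'} T, Y_{E'} T)`.  These are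
the fibre statements of the block-freezing step on larger graphs (THEOREM Θ² programme) and give PR4 for the cycle with pendant trees.
Proof = the cells of …AntitheticCycleTII with the forced indices added to the red pattern (cells with a forced blue pair dropped).
[cite: VandenbergHaggstromKahn2005, §1 p. 6 ("Harris' inequality"), §1 p. 3 (open cluster `C_s`)]
-/

noncomputable section

namespace Summit.CriticalPhenomena.PercolationContinuityZ3.Theorems

open Literature.Probability.Percolation
open scoped Classical

namespace Antithetic

namespace Cyc

variable {V : Type*} {n : ℕ} {v : ℕ → V} (hn : 3 ≤ n) (hinj : ∀ i j, i < n → j < n → v i = v j → i = j) (hper : v n = v 0)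
include hn hinj hper

/-- **PR4 ON A CYCLE, extension form with forced-red pairs.**  `E'` any edge set on which the events `{P ∈ X}`, `{Q ∉ Y}` and red
domination are those of the cycle (hev, hevY, hdomx — e.g. the cycle with pendant trees), `frc` a set of forced-red cycle indices,
`P = v p`, `Q = v q` (`0 < p, q < n`).  Then for all super-odd twisted-monotone `K₁, K₂`:
`0 ≤ Σ_{ω : forced pairs red, P ∈ X_{E'} ω, Q ∉ Y_{E'} ω} K₁(X_{E'} ω, Y_{E'} ω)·K₂(X_{E'} ω, Y_{E'} ω)`. [this work] -/
theorem termTwo_cycle_ext [Fintype V] {p q : ℕ} (hp0 : 0 < p) (hpn : p < n) (hq0 : 0 < q) (hqn : q < n)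
    (frc : ℕ → Prop) (E' : Set (Sym2 V))
    (hev : ∀ T : Set (Sym2 V), v p ∈ openCluster (T ∩ E') (v 0) ↔ v p ∈ openCluster (T ∩ edgeSet n v) (v 0))
    (hevY : ∀ T : Set (Sym2 V), v q ∈ openCluster (Tᶜ ∩ E') (v 0) ↔ v q ∈ openCluster (Tᶜ ∩ edgeSet n v) (v 0))
    (hdomx : ∀ T T' : Set (Sym2 V), (∀ e ∉ edgeSet n v, (e ∈ T' ↔ e ∉ T)) →
      openCluster (T'ᶜ ∩ edgeSet n v) (v 0) ⊆ openCluster (T ∩ edgeSet n v) (v 0) →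
      openCluster (T'ᶜ ∩ E') (v 0) ⊆ openCluster (T ∩ E') (v 0))
    (K₁ K₂ : Set V → Set V → ℝ)
    (hK₁ : ∀ ⦃P P' Q Q' : Set V⦄, P ⊆ P' → Q' ⊆ Q → K₁ P Q ≤ K₁ P' Q') (hso₁ : ∀ P Q, 0 ≤ K₁ P Q + K₁ Q P)
    (hK₂ : ∀ ⦃P P' Q Q' : Set V⦄, P ⊆ P' → Q' ⊆ Q → K₂ P Q ≤ K₂ P' Q') (hso₂ : ∀ P Q, 0 ≤ K₂ P Q + K₂ Q P) :
    0 ≤ ∑ ω ∈ Finset.univ.filter (fun ω : Set (Sym2 V) =>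
        (∀ i, i < n → frc i → edge v i ∈ ω) ∧ (v p ∈ openCluster (ω ∩ E') (v 0) ∧ v q ∉ openCluster (ωᶜ ∩ E') (v 0))),
      K₁ (openCluster (ω ∩ E') (v 0)) (openCluster (ωᶜ ∩ E') (v 0)) *
        K₂ (openCluster (ω ∩ E') (v 0)) (openCluster (ωᶜ ∩ E') (v 0)) := by
  -- index bookkeeping: a cell is `t = (i₀, j₀, c)`: `edge i₀`, `edge j₀` red (`i₀ < q ≤ j₀ < n`), the pairs strictly between blue; `c` selects
  -- the sub-box: `c = n` TOP / `c < n` ⊕-BOX `c` (only when the blue arc is trivial), `c = n+1` clockwise path to `P` red, `c = n+2`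
  -- counter-clockwise path to `P` red.
  let arc : ℕ → ℕ → Prop := fun k i => (k < p ∧ k < i) ∨ (p ≤ k ∧ i < k)
  let redI : ℕ → ℕ → ℕ → ℕ → Prop := fun i₀ j₀ cc i =>
    i = i₀ ∨ i = j₀ ∨ cc = n ∨ (cc < n ∧ arc cc i) ∨ (cc = n + 1 ∧ i < p) ∨ (cc = n + 2 ∧ p ≤ i) ∨ frc i
  let blueI : ℕ → ℕ → ℕ → ℕ → Prop := fun i₀ j₀ cc i => (i₀ < i ∧ i < j₀) ∨ (cc < n ∧ i = cc)
  let valid : ℕ → ℕ → ℕ → Prop := fun i₀ j₀ cc => (i₀ < q ∧ q ≤ j₀ ∧ j₀ < n ∧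
    ((i₀ + 1 = q ∧ j₀ = q ∧ (cc = n ∨ (cc < n ∧ cc ≠ q - 1 ∧ cc ≠ q))) ∨
      (i₀ + 2 ≤ j₀ ∧ p ≤ i₀ + 1 ∧ cc = n + 1) ∨ (i₀ + 2 ≤ j₀ ∧ j₀ ≤ p ∧ cc = n + 2))) ∧
    (∀ i, blueI i₀ j₀ cc i → ¬ frc i)
  let C := {t : ℕ × ℕ × ℕ // valid t.1 t.2.1 t.2.2}
  let Fix : C → Set (Sym2 V) := fun c =>
    {e | ∃ i, i < n ∧ (redI c.1.1 c.1.2.1 c.1.2.2 i ∨ blueI c.1.1 c.1.2.1 c.1.2.2 i) ∧ e = edge v i}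
  let N : C → Set (Sym2 V) := fun c => {e | ∃ i, i < n ∧ redI c.1.1 c.1.2.1 c.1.2.2 i ∧ e = edge v i}
  have hedge_inj : ∀ {i i' : ℕ}, i < n → i' < n → edge v i = edge v i' → i = i' := fun hi hi' h => edge_inj hn hinj hper hi hi' h
  -- forced-red and forced-blue indices are disjoint
  have hdisj : ∀ i₀ j₀ cc, valid i₀ j₀ cc → ∀ i, i < n → redI i₀ j₀ cc i → blueI i₀ j₀ cc i → False := by
    intro i₀ j₀ cc hv i hi hr hb
    obtain ⟨hv1, hv2⟩ := hv
    have hnf : ¬ frc i := hv2 i hb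
    rcases hr with hr | hr | hr | hr | hr | hr | hr
    all_goals first
      | exact hnf hr
      | (simp only [blueI, arc] at hr hb hv1; omega)
  -- membership in a cell, spelled out
  have hmem_iff : ∀ i₀ j₀ cc (hv : valid i₀ j₀ cc) (ω : Set (Sym2 V)),
      (∀ e ∈ Fix ⟨(i₀, j₀, cc), hv⟩, (e ∈ ω ↔ e ∈ N ⟨(i₀, j₀, cc), hv⟩)) ↔
        ((∀ i, i < n → blueI i₀ j₀ cc i → edge v i ∉ ω) ∧ ∀ i, i < n → redI i₀ j₀ cc i → edge v i ∈ ω) := by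
    intro i₀ j₀ cc hv ω
    have hmemN : ∀ i, i < n → (edge v i ∈ N ⟨(i₀, j₀, cc), hv⟩ ↔ redI i₀ j₀ cc i) := by
      intro i hi
      constructor
      · rintro ⟨i', hi', hred, he⟩
        rw [hedge_inj hi hi' he]; exact hred
      · exact fun h => ⟨i, hi, h, rfl⟩
    constructor
    · intro h
      refine ⟨fun i hi hb hiω => ?_, fun i hi hred => ?_⟩
      · have h1 := (h (edge v i) ⟨i, hi, Or.inr hb, rfl⟩).1 hiω
        rw [hmemN i hi] at h1
        exact hdisj i₀ j₀ cc hv i hi h1 hb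
      · exact (h (edge v i) ⟨i, hi, Or.inl hred, rfl⟩).2 ((hmemN i hi).2 hred)
    · rintro ⟨hblues, hreds⟩ e ⟨i, hi, hor, rfl⟩
      rw [hmemN i hi]
      rcases hor with hred | hb
      · exact iff_of_true (hreds i hi hred) hred
      · exact iff_of_false (hblues i hi hb) (fun hred => hdisj i₀ j₀ cc hv i hi hred hb)
  refine Box.boxes_sum_nonneg E' (v 0) _ Fix N ?_ ?_ ?_ ?_ hK₁ hso₁ hK₂ hso₂
  · -- COVER
    intro ω hω
    obtain ⟨hfrc, hP', hQ'⟩ := (Finset.mem_filter.1 hω).2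
    have hP : v p ∈ openCluster (ω ∩ edgeSet n v) (v 0) := (hev ω).1 hP'
    have hQ : v q ∉ openCluster (ωᶜ ∩ edgeSet n v) (v 0) := fun h => hQ' ((hevY ω).2 h)
    obtain ⟨⟨i₁, hi₁q, hi₁⟩, ⟨j₁, hqj₁, hj₁n, hj₁⟩⟩ := (not_mem_Y_iff hn hinj hper ω hq0 hqn).1 hQ
    -- the largest red index below `q`
    have hexI : ∃ m, m < q ∧ edge v (q - 1 - m) ∈ ω :=
      ⟨q - 1 - i₁, by omega, by rwa [show q - 1 - (q - 1 - i₁) = i₁ by omega]⟩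
    have hspI := Nat.find_spec hexI
    have hi₀max : ∀ m, q - 1 - Nat.find hexI < m → m < q → edge v m ∉ ω := by
      intro m h1 h2 hm
      have hmin := Nat.find_min hexI (m := q - 1 - m) (by omega)
      exact hmin ⟨by omega, by rwa [show q - 1 - (q - 1 - m) = m by omega]⟩
    obtain ⟨i₀, hi₀def⟩ : ∃ i₀, i₀ = q - 1 - Nat.find hexI := ⟨_, rfl⟩
    have hi₀red : edge v i₀ ∈ ω := by rw [hi₀def]; exact hspI.2
    rw [← hi₀def] at hi₀max
    have hi₀q : i₀ < q := by omega
    -- the smallest red index `≥ q`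
    have hexJ : ∃ j, q ≤ j ∧ j < n ∧ edge v j ∈ ω := ⟨j₁, hqj₁, hj₁n, hj₁⟩
    have hspJ := Nat.find_spec hexJ
    have hj₀min : ∀ m, q ≤ m → m < Nat.find hexJ → edge v m ∉ ω := by
      intro m h1 h2 hm
      exact Nat.find_min hexJ h2 ⟨h1, by omega, hm⟩
    obtain ⟨j₀, hj₀def⟩ : ∃ j₀, j₀ = Nat.find hexJ := ⟨_, rfl⟩
    rw [← hj₀def] at hspJ hj₀min
    obtain ⟨hqj₀, hj₀n, hj₀red⟩ := hspJ
    have hblue : ∀ m, i₀ < m → m < j₀ → edge v m ∉ ω := by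
      intro m h1 h2
      by_cases hmq : m < q
      · exact hi₀max m h1 hmq
      · exact hj₀min m (by omega) h2
    -- a member of the cell `(i₀, j₀, cc)` as soon as the sub-box conditions hold
    have hmk : ∀ (cc : ℕ), (i₀ < q ∧ q ≤ j₀ ∧ j₀ < n ∧
          ((i₀ + 1 = q ∧ j₀ = q ∧ (cc = n ∨ (cc < n ∧ cc ≠ q - 1 ∧ cc ≠ q))) ∨
            (i₀ + 2 ≤ j₀ ∧ p ≤ i₀ + 1 ∧ cc = n + 1) ∨ (i₀ + 2 ≤ j₀ ∧ j₀ ≤ p ∧ cc = n + 2))) → (cc < n → edge v cc ∉ ω) →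
        (∀ i, i < n → (cc = n ∨ (cc < n ∧ arc cc i) ∨ (cc = n + 1 ∧ i < p) ∨ (cc = n + 2 ∧ p ≤ i) ∨ frc i) → edge v i ∈ ω) →
        ∃ c : C, ∀ e ∈ Fix c, (e ∈ ω ↔ e ∈ N c) := by
      intro cc hvold hcb hcr
      have hbl : ∀ i, blueI i₀ j₀ cc i → edge v i ∉ ω := by
        intro i hb
        rcases hb with ⟨h1, h2⟩ | ⟨h1, h2⟩
        · exact hblue i h1 h2
        · rw [h2]; exact hcb h1
      have hv : valid i₀ j₀ cc := ⟨hvold, fun i hb hf => hbl i hb (hfrc i (by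
          rcases hb with ⟨h1, h2⟩ | ⟨h1, h2⟩
          · omega
          · omega) hf)⟩
      refine ⟨⟨(i₀, j₀, cc), hv⟩, (hmem_iff i₀ j₀ cc hv ω).2 ⟨fun i hi hb => hbl i hb, fun i hi hred => ?_⟩⟩
      rcases hred with h | h | h
      · rw [h]; exact hi₀red
      · rw [h]; exact hj₀red
      · exact hcr i hi h
    by_cases htriv : i₀ + 1 = q ∧ j₀ = q
    · -- trivial blue arc: refine by the ⊕-boxes
      rcases oplus_cover hn hinj hper hp0 hpn ω hP with htop | ⟨k, hk, hbk, hbox⟩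
      · exact hmk n ⟨hi₀q, hqj₀, hj₀n, Or.inl ⟨htriv.1, htriv.2, Or.inl rfl⟩⟩ (fun h => absurd h (lt_irrefl n))
          fun i hi _ => htop i hi
      · have hk1 : k ≠ q - 1 := fun h => hbk (by rw [h, show q - 1 = i₀ by omega]; exact hi₀red)
        have hk2 : k ≠ q := fun h => hbk (by rw [h, ← htriv.2]; exact hj₀red)
        refine hmk k ⟨hi₀q, hqj₀, hj₀n, Or.inl ⟨htriv.1, htriv.2, Or.inr ⟨hk, hk1, hk2⟩⟩⟩ (fun _ => hbk) fun i hi h => ?_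
        rcases h with h | ⟨-, h⟩ | ⟨h, -⟩ | ⟨h, -⟩ | h
        · omega
        · exact hbox i hi h
        · omega
        · omega
        · exact hfrc i hi h
    · have hgap : i₀ + 2 ≤ j₀ := by omega
      rcases (mem_X_iff hn hinj hper ω hp0 hpn).1 hP with hcw | hccw
      · have hpi : p ≤ i₀ + 1 := by
          by_contra h
          exact hblue (i₀ + 1) (by omega) (by omega) (hcw (i₀ + 1) (by omega))
        refine hmk (n + 1) ⟨hi₀q, hqj₀, hj₀n, Or.inr (Or.inl ⟨hgap, hpi, rfl⟩)⟩ (fun h => absurd h (by omega)) fun i hi h => ?_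
        rcases h with h | ⟨h, -⟩ | ⟨-, h⟩ | ⟨h, -⟩ | h
        · omega
        · omega
        · exact hcw i h
        · omega
        · exact hfrc i hi h
      · have hpj : j₀ ≤ p := by
          by_contra h
          exact hblue (j₀ - 1) (by omega) (by omega) (hccw (j₀ - 1) (by omega) (by omega))
        refine hmk (n + 2) ⟨hi₀q, hqj₀, hj₀n, Or.inr (Or.inr ⟨hgap, hpj, rfl⟩)⟩ (fun h => absurd h (by omega)) fun i hi h => ?_
        rcases h with h | ⟨h, -⟩ | ⟨h, -⟩ | ⟨-, h⟩ | h
        · omega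
        · omega
        · omega
        · exact hccw i h hi
        · exact hfrc i hi h
  · -- INSIDE
    rintro ⟨⟨i₀, j₀, cc⟩, hv⟩ ω hmem
    obtain ⟨hblues, hreds⟩ := (hmem_iff i₀ j₀ cc hv ω).1 hmem
    have hv' : valid i₀ j₀ cc := hv
    obtain ⟨⟨hi₀q, hqj₀, hj₀n, hcase⟩, -⟩ := hv'
    refine Finset.mem_filter.2 ⟨Finset.mem_univ _, fun i hi hf => hreds i hi (Or.inr (Or.inr (Or.inr (Or.inr (Or.inr (Or.inr hf)))))), ?_, ?_⟩
    · -- `P ∈ X`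
      rw [hev ω]
      rcases hcase with ⟨-, -, hc | ⟨hc, -, -⟩⟩ | ⟨-, hpi, hc⟩ | ⟨-, hpj, hc⟩
      · exact mem_X_of_top hn hinj hper hp0 hpn ω fun i hi => hreds i hi (Or.inr (Or.inr (Or.inl hc)))
      · exact mem_X_of_box hn hinj hper hp0 hpn ω hc fun i hi harc => hreds i hi (Or.inr (Or.inr (Or.inr (Or.inl ⟨hc, harc⟩))))
      · exact (mem_X_iff hn hinj hper ω hp0 hpn).2
          (Or.inl fun i hi => hreds i (by omega) (Or.inr (Or.inr (Or.inr (Or.inr (Or.inl ⟨hc, hi⟩))))))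
      · exact (mem_X_iff hn hinj hper ω hp0 hpn).2
          (Or.inr fun i hpi' hin => hreds i hin (Or.inr (Or.inr (Or.inr (Or.inr (Or.inr (Or.inl ⟨hc, hpi'⟩)))))))
    · -- `Q ∉ Y`
      rw [hevY ω]
      exact (not_mem_Y_iff hn hinj hper ω hq0 hqn).2
        ⟨⟨i₀, hi₀q, hreds i₀ (by omega) (Or.inl rfl)⟩, ⟨j₀, hqj₀, hj₀n, hreds j₀ hj₀n (Or.inr (Or.inl rfl))⟩⟩
  · -- UNIQUENESS
    rintro ⟨⟨i₀, j₀, cc⟩, hv⟩ ⟨⟨i₀', j₀', cc'⟩, hv'⟩ ω hmem hmem'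
    obtain ⟨hblues, hreds⟩ := (hmem_iff i₀ j₀ cc hv ω).1 hmem
    obtain ⟨hblues', hreds'⟩ := (hmem_iff i₀' j₀' cc' hv' ω).1 hmem'
    have hv1' : valid i₀ j₀ cc := hv
    have hv2' : valid i₀' j₀' cc' := hv'
    simp only [valid] at hv1' hv2'
    obtain ⟨hv1, -⟩ := hv1'
    obtain ⟨hv2, -⟩ := hv2'
    have hred₀ : edge v i₀ ∈ ω := hreds i₀ (by omega) (Or.inl rfl)
    have hred₀' : edge v i₀' ∈ ω := hreds' i₀' (by omega) (Or.inl rfl)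
    have hred₁ : edge v j₀ ∈ ω := hreds j₀ (by omega) (Or.inr (Or.inl rfl))
    have hred₁' : edge v j₀' ∈ ω := hreds' j₀' (by omega) (Or.inr (Or.inl rfl))
    have hI : i₀ = i₀' := by
      by_contra hne
      rcases Nat.lt_or_gt_of_ne hne with h | h
      · exact hblues i₀' (by omega) (Or.inl ⟨h, by omega⟩) hred₀'
      · exact hblues' i₀ (by omega) (Or.inl ⟨h, by omega⟩) hred₀
    have hJ : j₀ = j₀' := by
      by_contra hne
      rcases Nat.lt_or_gt_of_ne hne with h | h
      · exact hblues' j₀ (by omega) (Or.inl ⟨by omega, h⟩) hred₁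
      · exact hblues j₀' (by omega) (Or.inl ⟨by omega, h⟩) hred₁'
    subst hI hJ
    have hcc : cc = cc' := by
      -- a ⊕-box index is determined (`box_uniq`), TOP and a ⊕-box exclude each other, the path boxes are determined by `p`
      by_cases h1 : cc < n
      · have hb1 : edge v cc ∉ ω := hblues cc h1 (Or.inr ⟨h1, rfl⟩)
        by_cases h2 : cc' < n
        · have hb2 : edge v cc' ∉ ω := hblues' cc' h2 (Or.inr ⟨h2, rfl⟩)
          exact box_uniq (p := p) ω h1 h2 hb1 (fun i hi harc => hreds i hi (Or.inr (Or.inr (Or.inr (Or.inl ⟨h1, harc⟩)))))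
            hb2 (fun i hi harc => hreds' i hi (Or.inr (Or.inr (Or.inr (Or.inl ⟨h2, harc⟩)))))
        · have h3 : cc' = n := by omega
          exact absurd (hreds' cc h1 (Or.inr (Or.inr (Or.inl h3)))) hb1
      · by_cases h2 : cc' < n
        · have hb2 : edge v cc' ∉ ω := hblues' cc' h2 (Or.inr ⟨h2, rfl⟩)
          have h3 : cc = n := by omega
          exact absurd (hreds cc' h2 (Or.inr (Or.inr (Or.inl h3)))) hb2
        · omega
    subst hcc
    rfl
  · -- RED DOMINATION
    rintro ⟨⟨i₀, j₀, cc⟩, hv⟩ ω ω' hmem hmem' hflip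
    obtain ⟨hblues, hreds⟩ := (hmem_iff i₀ j₀ cc hv ω).1 hmem
    obtain ⟨hblues', hreds'⟩ := (hmem_iff i₀ j₀ cc hv ω').1 hmem'
    have hv1 : valid i₀ j₀ cc := hv
    obtain ⟨⟨hi₀q, hqj₀, hj₀n, hcase⟩, -⟩ := hv1
    refine hdomx ω ω' (fun e he => hflip e fun hmemF => he ?_) ?_
    · obtain ⟨i, hi, -, rfl⟩ := hmemF
      exact ⟨i, hi, rfl⟩
    -- a pair that is neither forced red nor forced blue is free
    have hfl : ∀ i, i < n → ¬ redI i₀ j₀ cc i → ¬ blueI i₀ j₀ cc i → (edge v i ∈ ω' ↔ edge v i ∉ ω) := by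
      intro i hi hr hb
      refine hflip (edge v i) fun hmemF => ?_
      obtain ⟨i', hi', hor, he⟩ := hmemF
      have hii' := hedge_inj hi hi' he
      subst hii'
      exact hor.elim hr hb
    rcases hcase with ⟨hi₀1, hj₀1, hc | ⟨hc, hc1, hc2⟩⟩ | ⟨hgap, hpi, hc⟩ | ⟨hgap, hpj, hc⟩
    · exact dom_top hn hinj hper ω ω' fun i hi => hreds' i hi (Or.inr (Or.inr (Or.inl hc)))
    · refine dom_box hn hinj hper ω ω' (k := cc) (redI i₀ j₀ cc) ?_ hreds hreds' fun i hi hik hnred => ?_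
      · by_cases hkp : cc < p
        · exact Or.inl ⟨by omega, fun i hki hin => Or.inr (Or.inr (Or.inr (Or.inl ⟨hc, Or.inl ⟨hkp, hki⟩⟩)))⟩
        · exact Or.inr ⟨by omega, fun i hik => Or.inr (Or.inr (Or.inr (Or.inl ⟨hc, Or.inr ⟨by omega, hik⟩⟩)))⟩
      · refine hfl i hi hnred fun hb => ?_
        rcases hb with ⟨h1, h2⟩ | ⟨-, h2⟩
        · omega
        · exact hik h2
    · refine dom_cw hn hinj hper ω ω' hj₀n (redI i₀ j₀ cc) ?_ (Or.inr (Or.inl rfl)) hreds' fun i hji hin hnred => ?_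
      · exact Or.inr (Or.inr (Or.inr (Or.inr (Or.inl ⟨hc, hp0⟩))))
      · refine hfl i hin hnred fun hb => ?_
        rcases hb with ⟨h1, h2⟩ | ⟨h1, -⟩
        · omega
        · omega
    · refine dom_ccw hn hinj hper ω ω' (show i₀ < n by omega) (redI i₀ j₀ cc) ?_ (Or.inl rfl) hreds' fun i hii hnred => ?_
      · exact Or.inr (Or.inr (Or.inr (Or.inr (Or.inr (Or.inl ⟨hc, by omega⟩)))))
      · refine hfl i (by omega) hnred fun hb => ?_
        rcases hb with ⟨h1, h2⟩ | ⟨h1, -⟩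
        · omega
        · omega

end Cyc

end Antithetic

end Summit.CriticalPhenomena.PercolationContinuityZ3.Theorems
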